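import Mathlib
import HarnessLib
import Summits.AtomisticToContinuum.HydrodynamicLimit.Theorems.RelayRaceLocalityConeLocalisationDefs
import Summits.AtomisticToContinuum.HydrodynamicLimit.Theorems.RelayRaceLocalityConeLocalisationTestAssembly
import Summits.AtomisticToContinuum.HydrodynamicLimit.Theorems.SuperextensiveClosureCostBlockEntropyBudgetBallAverages
import Literature.MathematicalPhysics.KineticTheory.HardSphereEulerSolutionGluing

/-!
# RelayRaceLocality · ConeLocalisation — partition-of-unity assembly `LocalFlooredLLN → S♭`

Support file for the crux item `stmt-AtomisticToContinuum-12504` (`ConeLocalisation`, route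
RelayRaceLocality of `AtomisticToContinuum/HydrodynamicLimit`), line `zoomed-bubble-transplant`,
stub `stub_assembly` of the skeleton `Cruxes/ConeLocalisation/Lines/Sketch.lean`.

`LocalFlooredLLN` (`Theorems/RelayRaceLocalityConeLocalisationDefs.lean`) gives, for every `M`,
a localisation radius `r = r(M) > 0` and — for every finite set of centres `C ⊂ 𝕋³` fixed before
the profile — the three-field law of large numbers at time `t` for every continuous test function
vanishing outside the `r`-ball of some centre `c ∈ C`. `ShortTimeGuardedHLFloored` (`S♭`) asks
for it for EVERY continuous test function. The glue:

* `relayRaceLocality_exists_finset_net` — compactness of `𝕋³ = UnitAddTorus (Fin 3)`: a finite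
  `r/2`-net `C` for the minimal-image distance `Torus.euclidDist` (its balls are open since
  `euclidDist` is continuous, `continuous_euclidDist_left`);
* `relayRaceLocality_exists_partition` — the partition of unity subordinate to the `r`-balls of
  an `r/2`-net: bumps `g_c = (1 - 2·euclidDist(·, c)/r)₊`, `φ_c = g_c / ∑_{c'} g_{c'}`
  (denominator `> 0` by the net property), so every continuous `χ` is the finite sum `∑_c χ φ_c`
  of continuous functions each vanishing where `r ≤ euclidDist(·, c)`;
* `stub_assembly` — thread the quantifier prefix, fix the net `C` right after `r`, and conclude
  with `relayRaceLocality_tendstoHydroFieldsAt_of_local` (finite additivity of the LLN in the test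
  function), the time-`t` slices of a classical solution being continuous
  (`IsHardSphereEulerSolution.isSmooth_slices`).
-/

noncomputable section

namespace Summit.AtomisticToContinuum.HydrodynamicLimit.Theorems.ConeLocalisation

open scoped Topology
open Filter Set MeasureTheory
open Literature.MathematicalPhysics.KineticTheory Literature.Analysis.FluidPDE
  Literature.Analysis.FunctionSpaces
open Summit.AtomisticToContinuum.HydrodynamicLimit.Theses.RelayRaceLocality

/-- **Finite nets of the torus.** For every `ε > 0` there is a finite set `C ⊂ 𝕋³` such that
every point of `𝕋³` is at minimal-image distance `< ε` from some `c ∈ C` (compactness of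
`UnitAddTorus (Fin 3)`; the `euclidDist`-balls are open). [folklore] -/
theorem relayRaceLocality_exists_finset_net {ε : ℝ} (hε : 0 < ε) :
    ∃ C : Finset T3, ∀ x : T3, ∃ c ∈ C, Torus.euclidDist x c < ε := by
  obtain ⟨C, hC⟩ := CompactSpace.elim_nhds_subcover (X := T3)
    (fun c => {x | Torus.euclidDist x c < ε}) fun c =>
      (isOpen_lt (continuous_euclidDist_left c) continuous_const).mem_nhds
        (by simp [Torus.euclidDist_self, hε])
  refine ⟨C, fun x => ?_⟩
  have hx : x ∈ ⋃ c ∈ C, {x | Torus.euclidDist x c < ε} := by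
    rw [hC]
    trivial
  simpa [Set.mem_iUnion] using hx

/-- **Partition of unity subordinate to the `r`-balls of an `r/2`-net.** If every point of `𝕋³`
is at minimal-image distance `< r/2` from some centre of the finite set `C`, then every continuous
`χ : 𝕋³ → ℝ` is a finite sum `∑ k, ψ k` (indexed by `Fin n`) of continuous functions each of which
vanishes where `r ≤ euclidDist(·, c)` for some `c ∈ C`: take `ψ_c = χ · g_c / ∑_{c'} g_{c'}` with
the bumps `g_c = max 0 (1 - 2·euclidDist(·, c)/r)`. [folklore] -/
theorem relayRaceLocality_exists_partition {r : ℝ} (hr : 0 < r) (C : Finset T3)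
    (hC : ∀ x : T3, ∃ c ∈ C, Torus.euclidDist x c < r / 2) (χ : T3 → ℝ) (hχ : Continuous χ) :
    ∃ (n : ℕ) (ψ : Fin n → T3 → ℝ),
      (∀ k, Continuous (ψ k) ∧ ∃ c ∈ C, ∀ x, r ≤ Torus.euclidDist x c → ψ k x = 0) ∧
        χ = ∑ k, ψ k := by
  classical
  -- the bumps and their (everywhere positive) sum
  set g : T3 → T3 → ℝ := fun c x => max 0 (1 - 2 * Torus.euclidDist x c / r) with hg_def
  have hg_cont : ∀ c, Continuous (g c) := fun c =>
    continuous_const.max (continuous_const.sub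
      ((continuous_const.mul (continuous_euclidDist_left c)).div_const r))
  have hg_nonneg : ∀ c x, 0 ≤ g c x := fun c x => le_max_left _ _
  have hg_zero : ∀ c x, r ≤ Torus.euclidDist x c → g c x = 0 := by
    intro c x hx
    have h2 : 2 ≤ 2 * Torus.euclidDist x c / r := by
      rw [le_div_iff₀ hr]
      nlinarith
    simp only [hg_def]
    exact max_eq_left (by linarith)
  set S : T3 → ℝ := fun x => ∑ c ∈ C, g c x with hS_def
  have hS_cont : Continuous S := continuous_finsetSum C fun c _ => hg_cont c
  have hS_pos : ∀ x, 0 < S x := by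
    intro x
    obtain ⟨c, hc, hxc⟩ := hC x
    have hgc : 0 < g c x := by
      have h1 : 2 * Torus.euclidDist x c / r < 1 := by
        rw [div_lt_one hr]
        linarith
      exact lt_max_of_lt_right (by linarith)
    exact lt_of_lt_of_le hgc (Finset.single_le_sum (fun c' _ => hg_nonneg c' x) hc)
  have hS_sum : ∀ x, ∑ c ∈ C, g c x / S x = 1 := fun x => by
    rw [← Finset.sum_div, div_self (hS_pos x).ne']
  -- enumerate the centres
  refine ⟨C.card, fun k x => χ x * (g (C.equivFin.symm k) x / S x), fun k => ⟨?_, ?_⟩, ?_⟩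
  · exact hχ.mul ((hg_cont _).div hS_cont fun x => (hS_pos x).ne')
  · refine ⟨C.equivFin.symm k, (C.equivFin.symm k).2, fun x hx => ?_⟩
    simp [hg_zero _ x hx]
  · funext x
    rw [Finset.sum_apply, ← Finset.mul_sum]
    have hre : ∑ k : Fin C.card, g (C.equivFin.symm k) x / S x = ∑ c ∈ C, g c x / S x := by
      rw [Equiv.sum_comp C.equivFin.symm (fun c : C => g c x / S x),
        Finset.sum_coe_sort C (fun c => g c x / S x)]
    rw [hre, hS_sum, mul_one]

/-- **STUB `stub_assembly` of the line `zoomed-bubble-transplant`: `LocalFlooredLLN → S♭`.** The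
local floored law of large numbers (three-field LLN at time `t` for test functions supported in
the `r(M)`-ball of a centre of an arbitrary finite set `C`, fixed before the profile) implies the
short-time guarded hydrodynamic limit with density floor: fix a finite `r/2`-net `C` of the
compact torus right after `r`, and reassemble an arbitrary continuous test function from the
partition of unity subordinate to the `r`-balls of `C` (`relayRaceLocality_exists_partition`,
`relayRaceLocality_tendstoHydroFieldsAt_of_local`). [folklore] -/
theorem stub_assembly : LocalFlooredLLN → ShortTimeGuardedHLFloored := by
  intro h
  obtain ⟨η₀, hη₀, H⟩ := h
  refine ⟨η₀, hη₀, fun M hM => ?_⟩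
  obtain ⟨τ₁, hτ₁, r, hr, H1⟩ := H M hM
  obtain ⟨C, hC⟩ := relayRaceLocality_exists_finset_net (half_pos hr)
  refine ⟨τ₁, hτ₁, fun a₀ θ₀ u₀ ha hθ hu ha0 hθ0 => ?_⟩
  obtain ⟨σ₀, hσ₀, H2⟩ := H1 C a₀ θ₀ u₀ ha hθ hu ha0 hθ0
  refine ⟨σ₀, hσ₀, fun σ hσ hσ' T ρ θ u hE Φ h0 t ht hg => ?_⟩
  have hsm := hE.isSmooth_slices ⟨ht.1, lt_of_lt_of_le ht.2 (min_le_left _ _)⟩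
  refine relayRaceLocality_tendstoHydroFieldsAt_of_local hsm.1.continuous hsm.2.1.continuous
    hsm.2.2.continuous {χ | Continuous χ ∧ ∃ c ∈ C, ∀ x, r ≤ Torus.euclidDist x c → χ x = 0}
    (fun χ hχ => hχ.1)
    (fun χ hχ δ hδ => H2 σ hσ hσ' T ρ θ u hE Φ h0 t ht hg χ hχ.1 hχ.2 δ hδ) fun χ hχ => ?_
  obtain ⟨n, ψ, hψ, hsum⟩ := relayRaceLocality_exists_partition hr C hC χ hχ
  exact ⟨n, ψ, hψ, hsum⟩

end Summit.AtomisticToContinuum.HydrodynamicLimit.Theorems.ConeLocalisation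

end
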